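import Mathlib.Analysis.SpecialFunctions.Trigonometric.Series
import Mathlib.Analysis.SpecialFunctions.Pow.Real
import Mathlib.Algebra.Order.BigOperators.Ring.Finset
import Mathlib.Algebra.BigOperators.Field
import HarnessLib

/-!
# The `Ω(√n/ε²)` sample-complexity lower bound for testing uniformity (Paninski 2008), via Le Cam's method

Topic `Literature/Probability/HypothesisTesting` (sibling of `NeymanPearsonLemma.lean`; serves the
pub-qadeq lane through `Literature/Computability/QuantumComplexity/CertificationSampleComplexity.lean`,
whose certification lower bounds take Valiant–Valiant's instance-optimal identity-testing theorem as a
HYPOTHESIS — this file PROVES that hypothesis' flat-target case, the one behind “sampling from flat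
distributions cannot be certified from the samples alone”).

HONEST FRAMING (pub-qadeq): instance-level adjudication of specific advantage claims; no claim about
BQP vs BPP or the summit.  This file is classical distribution-testing mathematics — finite sums,
Cauchy–Schwarz, `cosh b ≤ e^{b²/2}` — and asserts nothing about any device.

## Sources, verbatim

C. L. Canonne, *A Survey on Distribution Testing: Your Data is Big. But is it Blue?*, Theory of
Computing Graduate Surveys 9 (2020) [Canonne2020] (held text `paper:doi-10-4086-toc-gs-2020-009`,
CC-BY), restating and proving the lower bound of L. Paninski, *A coincidence-based test for uniformity
given very sparsely sampled discrete data*, IEEE Trans. Inform. Theory 54, 4750–4755 (2008)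
[Paninski2008] (its ref. [79]; paywalled original — formalised from the survey's restatement, both cited):

* §5.1, “An `Ω(√n/ε²)` lower bound” (p0009 L33 – p0010 L8): “taking without loss of generality the
  domain to be `[n]` and `n` to be even … the status of the `ε` one remained open until Paninski [79],
  who proved a matching `Ω(√n/ε²)` lower bound. The construction is, not surprisingly, very similar to
  the one above: a no-instance `D ∈ D_no` is defined by `n/2` independent coin tosses, according to which
  each consecutive pair of elements `2i − 1, 2i` is assigned weight either `(1 − 2ε)/n, (1 + 2ε)/n` or
  `(1 + 2ε)/n, (1 − 2ε)/n`. Each such distribution is thus being exactly `ε`-far from uniform. The proof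
  then goes by proving that as long as [`m ≲ √n/ε²`, `d_TV(U^{⊗m}, Ū) ≤ 1/3` where `Ū`] is the “expected
  distribution of a transcript of `m` samples from a randomly chosen no-distribution,” defined as
  `𝔼_{D∼D_no}[D^{⊗m}]` … writing [`d_TV` against the density `dP/dQ`] … (the last inequality by Jensen);
  now, expanding the inner square and massaging the explicit yet discouraging expression … one can
  finally obtain an upper bound of `(e^{m²ε⁴/n} − 1)^{1/2}`.”
* App. E.2, Theorem E.7 (Le Cam's method) and Corollary E.8 with “An application: testing uniformity.
  To prove a lower bound of `Ω(√n/ε²)` for testing uniformity over `[n]` (cf. Section 5.1), Paninski [79]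
  defines the families `D₁ = P = {U_n}` and `D₂` as the set of distributions `D` obtained by perturbing
  each disjoint pair of consecutive elements `(2i − 1, 2i)` by either `(ε/n, −ε/n)` or `(−ε/n, ε/n)` (for a
  total of `2^{n/2}` distinct distributions). He then analyzes the total variation distance between
  `U_n^{⊗m}` and the uniform mixture which for `m ≤ c√n/ε²` is less than `1/3` — establishing the lower
  bound.” (p0081 L19) — “As any (possibly randomized) bona fide testing algorithm can only fail with
  probability `1/3` …”.

## What is formalised (all proved, 0 named facts; explicit constants)

Sample space `Fin m × Bool` (`n = 2m` points, the `m` pairs), perturbation `η ∈ [−1, 1]` (the survey's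
`2ε`), `s` samples (the survey's `m`), transcripts `S : Fin s → Fin m × Bool`:

* `unif`, `paninski η z` (`P_z(j,b) = (1 + η σ(z_j)σ(b))/(2m)`, `z ∈ {0,1}^m`), `prodW` (`P^{⊗s}`), `accept`
  (`𝔼_{P^{⊗s}}[φ]` for a `[0,1]`-valued, possibly randomised test `φ`), `mix` (`Ū`); `sum_paninski`,
  `paninski_nonneg`, **`l1_paninski_unif`** (`‖P_z − U‖₁ = |η|` exactly).
* **Le Cam, event form** `accept_sub_le_half_l1` (`𝔼_p[φ] − 𝔼_q[φ] ≤ ½‖p − q‖₁`); **the χ² step**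
  `l1_sq_le_card_mul_sum_sq` (`‖p − U‖₁² ≤ K Σ p² − 1` against the uniform reference on `K` points);
  **Ingster's identity** `card_mul_sum_mix_sq` (`K Σ_S Ū(S)² = 2^{−2m} Σ_{z,z'}(1 + (η²/m)⟨σ(z),σ(z')⟩)^s`, via
  the overlap `overlap` and the product structure `sum_prodW_mul`); **the cosh computation**
  `sum_sum_exp_mul_sum_sgn` (`Σ_{z,z'} e^{b⟨σ(z),σ(z')⟩} = 2^m(2cosh b)^m`) and **the bound**
  `card_mul_sum_mix_sq_le` (`K Σ Ū² ≤ cosh(sη²/m)^m ≤ e^{s²η⁴/(2m)}`, Mathlib's `Real.cosh_le_exp_half_sq`).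
* **`accept_unif_sub_avg_le`**: `𝔼_{U^{⊗s}}[φ] − avg_z 𝔼_{P_z^{⊗s}}[φ] ≤ ½√(e^{s²η⁴/(2m)} − 1)` for every
  `[0,1]`-valued `φ` — the survey's `d_TV(U^{⊗m}, Ū)` bound in `ℓ₁/2` form with the constant in the exponent
  made explicit (`s²η⁴/(2m) = 16 s²ε⁴/n` in the survey's letters; the survey's display does not track it).
* **`samples_sq_gt`** (the lower bound, tester form with thresholds `2/3`, `1/3` as in Hangleiter et
  al.'s Definition 1): completeness `≥ 2/3` on `U` and acceptance `< 1/3` on every `P_z` force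
  `s²η⁴ > (8/13) m`, i.e. `s > 0.78 √m/η² ≈ 0.2 √n/η²`.
* v2 — **arbitrary (in particular odd) sample-space sizes** (section `padded`, removing the survey's
  “without loss of generality … `n` to be even”): on `PSpace m r = (Fin m × Bool) ⊕ Fin r` (`2m + r`
  points, the `r` extra points unperturbed) `unifP`, `paninskiP`, `mixP`; `sum_paninskiP`,
  `paninskiP_nonneg`, **`l1_paninskiP_unifP`** (`‖P_z − U‖₁ = |η|·2m/(2m+r)`), `overlapP`
  (`(1 + (2η²/(2m+r))⟨σ(z),σ(z')⟩)/(2m+r)`), `sum_mixP`, **`card_mul_sum_mixP_sq`** (Ingster, padded),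
  **`card_mul_sum_mixP_sq_le`** (`K Σ Ū² ≤ cosh(2sη²/(2m+r))^m ≤ e^{s²η⁴/(2m+r)}`),
  **`accept_unifP_sub_avg_le`** (`≤ ½√(e^{s²η⁴/(2m+r)} − 1)`) and **`samples_sq_gtP`**
  (`s²η⁴ > (4/13)(2m + r)`; for `r = 0` the statements above).

NOT formalised: Paninski's matching upper bound (the coincidence-counting tester), the general
(non-flat) Valiant–Valiant bound, Yao's principle (unnecessary here: the bound is proved for every
`[0,1]`-valued acceptance function directly).

## References

* [Paninski2008] L. Paninski, *A coincidence-based test for uniformity given very sparsely sampled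
  discrete data*, IEEE Trans. Inform. Theory 54(10), 4750–4755 (2008), doi:10.1109/TIT.2008.928987 — the
  `Ω(√n/ε²)` lower bound (original; read through the restatement below).
* [Canonne2020] C. L. Canonne, *A Survey on Distribution Testing: Your Data is Big. But is it Blue?*,
  Theory of Computing Library Graduate Surveys 9, 1–100 (2020), doi:10.4086/toc.gs.2020.009 — §5.1 and
  App. E.2 (Thm. E.7, Cor. E.8).
-/

noncomputable section

open Finset Real

namespace Literature.Probability.HypothesisTesting

namespace UniformityTesting

variable {m : ℕ}

/-- The sign `σ(b) = ±1` of a bit (`false ↦ 1`, `true ↦ −1`); plumbing. [folklore] -/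
def sgn (b : Bool) : ℝ := if b then -1 else 1

/-- Plumbing about `sgn`. [folklore] -/
private theorem sgn_mul_self (b : Bool) : sgn b * sgn b = 1 := by cases b <;> simp [sgn]

/-- Plumbing about `sgn`. [folklore] -/
private theorem sgn_sq (b : Bool) : sgn b ^ 2 = 1 := by rw [sq, sgn_mul_self]

/-- Plumbing about `sgn`. [folklore] -/
private theorem abs_sgn (b : Bool) : |sgn b| = 1 := by cases b <;> simp [sgn]

/-- Plumbing about `sgn`. [folklore] -/
private theorem sgn_xor (a b : Bool) : sgn (xor a b) = sgn a * sgn b := by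
  cases a <;> cases b <;> simp [sgn]

/-- The uniform distribution `U` on the `2m`-point sample space `Fin m × Bool` (the pairs
`{2i−1, 2i}` of “taking without loss of generality the domain to be [n] and n to be even”). [cite: Canonne2020, §5.1 (“An Ω(√n/ε²) lower bound”) and App. E.2] -/
def unif (m : ℕ) : Fin m × Bool → ℝ := fun _ => 1 / (2 * m)

/-- **Paninski's perturbed family**: “a no-instance `D ∈ D_no` is defined by `n/2` independent coin
tosses, according to which each consecutive pair of elements `2i − 1, 2i` is assigned weight either
`(1 − 2ε)/n, (1 + 2ε)/n` or `(1 + 2ε)/n, (1 − 2ε)/n`” — here with `n = 2m` and perturbation `η = 2ε`: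
`P_z(j, b) = (1 + η σ(z_j) σ(b))/(2m)`. [cite: Canonne2020, §5.1 (“An Ω(√n/ε²) lower bound”, construction of D_no)] [cite: Paninski2008, lower-bound construction (as restated in Canonne2020 §5.1 / App. E.2)] -/
def paninski (η : ℝ) (z : Fin m → Bool) : Fin m × Bool → ℝ :=
  fun x => (1 + η * sgn (z x.1) * sgn x.2) / (2 * m)

/-- The product weight `P^{⊗s}(S) = Π_k P(S_k)` of a sequence of `s` i.i.d. samples (a “transcript”).
[cite: Canonne2020, §5.1 (“An Ω(√n/ε²) lower bound”) and App. E.2] -/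
def prodW {E : Type*} (P : E → ℝ) {s : ℕ} (S : Fin s → E) : ℝ := ∏ k, P (S k)

/-- The acceptance probability `𝔼_{S ∼ P^{⊗s}}[φ(S)]` of a `[0,1]`-valued (possibly randomised) test `φ` on
`s` samples; for `φ = 1_A` this is `P^{⊗s}(A)`. [cite: Canonne2020, App. E.2 (testing algorithms with sample complexity m; Cor. E.8)] -/
def accept {E : Type*} [Fintype E] (P : E → ℝ) {s : ℕ} (φ : (Fin s → E) → ℝ) : ℝ :=
  ∑ S : Fin s → E, φ S * prodW P S

/-- The uniform mixture `Ū = 𝔼_{D ∼ D_no}[D^{⊗m}]` of the product distributions — “the expected distribution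
of a transcript of `m` samples from a randomly chosen no-distribution”. [cite: Canonne2020, §5.1 (definition of the mixture 𝔼_{D∼D_no}[D^{⊗m}])] -/
def mix (η : ℝ) (m s : ℕ) (S : Fin s → Fin m × Bool) : ℝ :=
  (∑ z : Fin m → Bool, prodW (paninski η z) S) / 2 ^ m

section basic
variable (hm : 0 < m)

/-- `|Fin m × Bool| = 2m` (plumbing). [folklore] -/
private theorem card_space : Fintype.card (Fin m × Bool) = 2 * m := by
  simp [Fintype.card_prod, mul_comm]

/-- Sums over the sample space split into the `m` pairs (plumbing). [folklore] -/
private theorem sum_space (f : Fin m × Bool → ℝ) :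
    ∑ x, f x = ∑ j : Fin m, (f (j, false) + f (j, true)) := by
  rw [Fintype.sum_prod_type]
  refine sum_congr rfl fun j _ => ?_
  rw [Fintype.sum_bool, add_comm]

include hm in
/-- `U` is a probability vector. [cite: Canonne2020, §5.1 (“An Ω(√n/ε²) lower bound”) and App. E.2] -/
theorem sum_unif : ∑ x, unif m x = 1 := by
  have : (m : ℝ) ≠ 0 := by exact_mod_cast hm.ne'
  simp only [unif, sum_const, card_univ, card_space, nsmul_eq_mul]
  field_simp
  push_cast; ring

include hm in
/-- Each `P_z` is a probability vector (the two weights of a pair sum to `2/(2m)`). [cite: Canonne2020, §5.1 (construction of D_no)] -/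
theorem sum_paninski (η : ℝ) (z : Fin m → Bool) : ∑ x, paninski η z x = 1 := by
  have : (m : ℝ) ≠ 0 := by exact_mod_cast hm.ne'
  rw [sum_space]
  simp only [paninski, sgn]
  simp only [Bool.false_eq_true, ↓reduceIte, mul_one, mul_neg, ← add_div]
  rw [← Finset.sum_div]
  have : ∀ j : Fin m, (1 + η * (if z j = true then (-1:ℝ) else 1)) +
      (1 + -(η * if z j = true then (-1:ℝ) else 1)) = 2 := fun j => by ring
  simp_rw [this]
  simp only [sum_const, card_univ, Fintype.card_fin, nsmul_eq_mul]
  field_simp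

/-- `P_z ≥ 0` for `|η| ≤ 1`. [cite: Canonne2020, §5.1 (construction of D_no)] -/
theorem paninski_nonneg {η : ℝ} (hη : |η| ≤ 1) (z : Fin m → Bool) (x : Fin m × Bool) :
    0 ≤ paninski η z x := by
  unfold paninski
  apply div_nonneg _ (by positivity)
  have h : |η * sgn (z x.1) * sgn x.2| ≤ 1 := by
    rw [abs_mul, abs_mul, abs_sgn, abs_sgn, mul_one, mul_one]; exact hη
  have := neg_abs_le (η * sgn (z x.1) * sgn x.2)
  linarith

include hm in
/-- **Each `P_z` is exactly `|η|`-far from uniform in `ℓ₁`** (“each such distribution is thus being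
exactly `ε`-far from uniform” in total variation `= ½ℓ₁`, with `η = 2ε`). [cite: Canonne2020, §5.1 (“Each such distribution is thus being exactly ε-far from uniform”)] -/
theorem l1_paninski_unif (η : ℝ) (z : Fin m → Bool) :
    ∑ x, |paninski η z x - unif m x| = |η| := by
  have hm' : (0 : ℝ) < m := by exact_mod_cast hm
  rw [sum_space]
  have : ∀ (j : Fin m) (b : Bool), |paninski η z (j, b) - unif m (j, b)| = |η| / (2 * m) := by
    intro j b
    unfold paninski unif
    rw [← sub_div, abs_div, abs_of_pos (by positivity : (0:ℝ) < 2 * m)]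
    congr 1
    rw [add_sub_cancel_left, abs_mul, abs_mul, abs_sgn, abs_sgn, mul_one, mul_one]
  simp_rw [this]
  simp only [sum_const, card_univ, Fintype.card_fin, nsmul_eq_mul]
  field_simp
  ring

end basic

section core
variable (hm : 0 < m)

/-- **The pair overlap**: `Σ_x P_z(x) P_{z'}(x) = (1 + (η²/m) Σ_j σ(z_j)σ(z'_j))/(2m)` — the quantity
whose `s`-th power Ingster's method averages. [cite: Canonne2020, §5.1 (“expanding the inner square”) and App. E.2] -/
theorem overlap (hm : 0 < m) (η : ℝ) (z z' : Fin m → Bool) :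
    ∑ x, paninski η z x * paninski η z' x =
      (1 + η ^ 2 / m * ∑ j, sgn (z j) * sgn (z' j)) / (2 * m) := by
  have hm' : (m : ℝ) ≠ 0 := by exact_mod_cast hm.ne'
  rw [sum_space]
  have hpair : ∀ j : Fin m, paninski η z (j, false) * paninski η z' (j, false) +
      paninski η z (j, true) * paninski η z' (j, true) =
      (2 + 2 * η ^ 2 * (sgn (z j) * sgn (z' j))) / (2 * m) ^ 2 := by
    intro j
    simp only [paninski, sgn, Bool.false_eq_true, ↓reduceIte]
    field_simp
    ring
  simp_rw [hpair]
  rw [← Finset.sum_div, Finset.sum_add_distrib, sum_const, card_univ, Fintype.card_fin, nsmul_eq_mul,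
    ← Finset.mul_sum]
  field_simp

/-- The product structure of transcripts: `Σ_S P^{⊗s}(S) Q^{⊗s}(S) = (Σ_x P(x)Q(x))^s`. [cite: Canonne2020, §5.1 (“An Ω(√n/ε²) lower bound”) and App. E.2] -/
theorem sum_prodW_mul {E : Type*} [Fintype E] (P Q : E → ℝ) (s : ℕ) :
    ∑ S : Fin s → E, prodW P S * prodW Q S = (∑ x, P x * Q x) ^ s := by
  rw [Fintype.sum_pow]
  refine sum_congr rfl fun S _ => ?_
  rw [prodW, prodW, ← prod_mul_distrib]

/-- `Σ_S P^{⊗s}(S) = (Σ_x P(x))^s`. [cite: Canonne2020, §5.1 (“An Ω(√n/ε²) lower bound”) and App. E.2] -/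
theorem sum_prodW {E : Type*} [Fintype E] (P : E → ℝ) (s : ℕ) :
    ∑ S : Fin s → E, prodW P S = (∑ x, P x) ^ s := by
  rw [Fintype.sum_pow]; rfl

/-- **Le Cam's method, event form**: for weight vectors `p, q` of equal total mass and any
`[0,1]`-valued acceptance function `φ`, `𝔼_p[φ] − 𝔼_q[φ] ≤ ½‖p − q‖₁ = d_TV(p, q)` — a test that must
accept under `p` and reject under `q` needs `d_TV(p, q)` large. [cite: Canonne2020, App. E.2 Thm. E.7 (Le Cam's method) and Cor. E.8] -/
theorem accept_sub_le_half_l1 {Ω : Type*} [Fintype Ω] (p q : Ω → ℝ) (hpq : ∑ ω, p ω = ∑ ω, q ω)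
    (φ : Ω → ℝ) (hφ0 : ∀ ω, 0 ≤ φ ω) (hφ1 : ∀ ω, φ ω ≤ 1) :
    ∑ ω, φ ω * p ω - ∑ ω, φ ω * q ω ≤ (∑ ω, |p ω - q ω|) / 2 := by
  have hzero : ∑ ω, (p ω - q ω) = 0 := by rw [sum_sub_distrib, hpq, sub_self]
  have key : ∑ ω, φ ω * (p ω - q ω) ≤ ∑ ω, (|p ω - q ω| + (p ω - q ω)) / 2 := by
    refine sum_le_sum fun ω _ => ?_
    have h1 := hφ0 ω; have h2 := hφ1 ω
    rcases le_or_gt 0 (p ω - q ω) with h | h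
    · rw [abs_of_nonneg h]; nlinarith
    · rw [abs_of_neg h]; nlinarith
  calc ∑ ω, φ ω * p ω - ∑ ω, φ ω * q ω = ∑ ω, φ ω * (p ω - q ω) := by
        rw [← sum_sub_distrib]; exact sum_congr rfl fun ω _ => by ring
    _ ≤ ∑ ω, (|p ω - q ω| + (p ω - q ω)) / 2 := key
    _ = (∑ ω, |p ω - q ω|) / 2 := by
        rw [← Finset.sum_div, sum_add_distrib, hzero, add_zero]

/-- **The χ² step against a uniform reference** (Cauchy–Schwarz): if `q ≡ c` on `K` points with `cK = 1`
and `Σ p = 1` then `‖p − q‖₁² ≤ K Σ_ω p(ω)² − 1` (`= χ²(p‖q)`). [cite: Canonne2020, §5.1 (“writing d_TV … dP/dQ … (the last inequality by Jensen)”) and App. E.2] -/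
theorem l1_sq_le_card_mul_sum_sq {Ω : Type*} [Fintype Ω] (p : Ω → ℝ) (hp : ∑ ω, p ω = 1)
    {c : ℝ} (hc : c * Fintype.card Ω = 1) :
    (∑ ω, |p ω - c|) ^ 2 ≤ Fintype.card Ω * ∑ ω, p ω ^ 2 - 1 := by
  have hCS := sum_mul_sq_le_sq_mul_sq (univ : Finset Ω) (fun ω => |p ω - c|) (fun _ => (1 : ℝ))
  simp only [mul_one, one_pow, sum_const, card_univ, nsmul_eq_mul, sq_abs] at hCS
  have hexp : ∑ ω, (p ω - c) ^ 2 = ∑ ω, p ω ^ 2 - 2 * c * ∑ ω, p ω + c ^ 2 * Fintype.card Ω := by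
    have : ∀ ω, (p ω - c) ^ 2 = p ω ^ 2 - 2 * c * p ω + c ^ 2 := fun ω => by ring
    simp only [this, sum_add_distrib, sum_sub_distrib, sum_const, card_univ, nsmul_eq_mul,
      ← Finset.mul_sum]
    ring
  rw [hexp, hp] at hCS
  have hK : (Fintype.card Ω : ℝ) * c = 1 := by rw [mul_comm]; exact hc
  nlinarith [hCS, hK]

end core

section ingster
variable (hm : 0 < m)

/-- `U^{⊗s}` is the constant `(2m)^{−s}`. [folklore] -/
private theorem prodW_unif (s : ℕ) (S : Fin s → Fin m × Bool) :
    prodW (unif m) S = (1 / (2 * m)) ^ s := by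
  simp [prodW, unif]

/-- There are `(2m)^s` transcripts. [folklore] -/
private theorem card_seq (s : ℕ) : Fintype.card (Fin s → Fin m × Bool) = (2 * m) ^ s := by
  rw [Fintype.card_fun, card_space, Fintype.card_fin]

include hm in
/-- The mixture is a probability vector on transcripts. [cite: Canonne2020, §5.1 (definition of the mixture)] -/
theorem sum_mix (η : ℝ) (s : ℕ) : ∑ S : Fin s → Fin m × Bool, mix η m s S = 1 := by
  unfold mix
  rw [← Finset.sum_div, sum_comm]
  simp_rw [sum_prodW, sum_paninski hm, one_pow]
  simp

/-- **Ingster's identity**: `K Σ_S Ū(S)² = 2^{−2m} Σ_{z,z'} (1 + (η²/m)⟨σ(z), σ(z')⟩)^s` for the `K = (2m)^s`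
transcripts — “expanding the inner square and massaging the explicit yet discouraging expression”.
[cite: Canonne2020, §5.1 (proof sketch of the Ω(√n/ε²) lower bound) and App. E.2] -/
theorem card_mul_sum_mix_sq (hm : 0 < m) (η : ℝ) (s : ℕ) :
    (Fintype.card (Fin s → Fin m × Bool) : ℝ) * ∑ S : Fin s → Fin m × Bool, mix η m s S ^ 2 =
      (∑ z : Fin m → Bool, ∑ z' : Fin m → Bool,
        (1 + η ^ 2 / m * ∑ j, sgn (z j) * sgn (z' j)) ^ s) / (2 ^ m * 2 ^ m) := by
  have hm' : (0 : ℝ) < m := by exact_mod_cast hm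
  rw [card_seq]
  push_cast
  have hsq : ∀ S : Fin s → Fin m × Bool, mix η m s S ^ 2 =
      (∑ z : Fin m → Bool, ∑ z' : Fin m → Bool,
        prodW (paninski η z) S * prodW (paninski η z') S) / (2 ^ m * 2 ^ m) := by
    intro S
    rw [mix, div_pow, sq, sum_mul_sum, sq]
  simp_rw [hsq]
  rw [← Finset.sum_div, sum_comm]
  simp_rw [Finset.sum_comm (s := (univ : Finset (Fin s → Fin m × Bool))), sum_prodW_mul,
    overlap hm, div_pow]
  rw [mul_div_assoc']
  congr 1
  rw [Finset.mul_sum]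
  refine sum_congr rfl fun z _ => ?_
  rw [Finset.mul_sum]
  refine sum_congr rfl fun z' _ => ?_
  have h2m : ((2 : ℝ) * m) ^ s ≠ 0 := by positivity
  field_simp

/-- `(1 + x)^s ≤ e^{sx}` for `1 + x ≥ 0` (plumbing). [folklore] -/
private theorem one_add_pow_le_exp_mul {x : ℝ} (hx : 0 ≤ 1 + x) (s : ℕ) :
    (1 + x) ^ s ≤ Real.exp (s * x) := by
  calc (1 + x) ^ s ≤ (Real.exp x) ^ s := by
        apply pow_le_pow_left₀ hx
        have := Real.add_one_le_exp x; linarith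
    _ = Real.exp (s * x) := by rw [← Real.exp_nat_mul]

/-- `⟨σ(z), σ(z')⟩ ≥ −m` (plumbing). [folklore] -/
private theorem neg_le_sum_sgn_mul (z z' : Fin m → Bool) : -(m : ℝ) ≤ ∑ j, sgn (z j) * sgn (z' j) := by
  have : ∀ j, (-1 : ℝ) ≤ sgn (z j) * sgn (z' j) := fun j => by
    cases z j <;> cases z' j <;> simp [sgn]
  calc -(m : ℝ) = ∑ _j : Fin m, (-1 : ℝ) := by simp
    _ ≤ _ := sum_le_sum fun j _ => this j

/-- **The `cosh` computation**: `Σ_{z,z'} exp(b⟨σ(z),σ(z')⟩) = 2^m (2 cosh b)^m` (re-index `z' ↦ z ⊕ z'`,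
then the sum over `{±1}^m` factorises). [cite: Canonne2020, §5.1 (proof sketch) and App. E.2] -/
theorem sum_sum_exp_mul_sum_sgn (b : ℝ) :
    ∑ z : Fin m → Bool, ∑ z' : Fin m → Bool, Real.exp (b * ∑ j, sgn (z j) * sgn (z' j)) =
      2 ^ m * (2 * Real.cosh b) ^ m := by
  -- for fixed `z`, re-index `z' ↦ z ⊕ z'`
  have hinner : ∀ z : Fin m → Bool, ∑ z' : Fin m → Bool, Real.exp (b * ∑ j, sgn (z j) * sgn (z' j)) =
      ∑ τ : Fin m → Bool, Real.exp (b * ∑ j, sgn (τ j)) := by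
    intro z
    have hinv : Function.Involutive (fun z' : Fin m → Bool => fun j => xor (z j) (z' j)) := by
      intro z'; funext j; cases z j <;> simp
    refine Fintype.sum_equiv hinv.toPerm _ _ fun z' => ?_
    simp only [Function.Involutive.coe_toPerm, sgn_xor]
  simp_rw [hinner, sum_const, card_univ, Fintype.card_fun, Fintype.card_bool, Fintype.card_fin,
    nsmul_eq_mul]
  push_cast
  congr 1
  simp_rw [Finset.mul_sum, Real.exp_sum]
  rw [← Fintype.prod_sum (fun (_ : Fin m) (c : Bool) => Real.exp (b * sgn c))]
  simp only [Fintype.sum_bool, sgn, ↓reduceIte, Bool.false_eq_true, mul_neg, mul_one,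
    prod_const, card_univ, Fintype.card_fin]
  congr 1
  rw [Real.cosh_eq]; ring

/-- **The χ² bound**: `K Σ_S Ū(S)² ≤ cosh(sη²/m)^m ≤ exp(s²η⁴/(2m))` for `η² ≤ 1` (with `cosh b ≤ e^{b²/2}`);
the survey's display of the resulting distance bound is “`(e^{m²ε⁴/n} − 1)^{1/2}`” (its `m` = our `s`, its
`n` = our `2m`, `ε = η/2`, constants in the exponent not tracked there). [cite: Canonne2020, §5.1 (“one can finally obtain an upper bound of (e^{m²ε⁴/n} − 1)^{1/2}”)] -/
theorem card_mul_sum_mix_sq_le (hm : 0 < m) {η : ℝ} (hη : η ^ 2 ≤ 1) (s : ℕ) :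
    (Fintype.card (Fin s → Fin m × Bool) : ℝ) * ∑ S : Fin s → Fin m × Bool, mix η m s S ^ 2 ≤
      Real.exp (s ^ 2 * η ^ 4 / (2 * m)) := by
  have hm' : (0 : ℝ) < m := by exact_mod_cast hm
  rw [card_mul_sum_mix_sq hm]
  set b : ℝ := s * (η ^ 2 / m) with hb
  have hstep : ∑ z : Fin m → Bool, ∑ z' : Fin m → Bool,
      (1 + η ^ 2 / m * ∑ j, sgn (z j) * sgn (z' j)) ^ s ≤
      ∑ z : Fin m → Bool, ∑ z' : Fin m → Bool, Real.exp (b * ∑ j, sgn (z j) * sgn (z' j)) := by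
    refine sum_le_sum fun z _ => sum_le_sum fun z' _ => ?_
    have hI := neg_le_sum_sgn_mul z z'
    have hx : 0 ≤ 1 + η ^ 2 / m * ∑ j, sgn (z j) * sgn (z' j) := by
      have h1 : η ^ 2 / m * (-(m : ℝ)) ≤ η ^ 2 / m * ∑ j, sgn (z j) * sgn (z' j) :=
        mul_le_mul_of_nonneg_left hI (by positivity)
      have h2 : η ^ 2 / m * (-(m : ℝ)) = -η ^ 2 := by field_simp
      linarith
    refine (one_add_pow_le_exp_mul hx s).trans (le_of_eq ?_)
    rw [hb]; ring_nf
  refine (div_le_div_of_nonneg_right hstep (by positivity)).trans ?_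
  rw [sum_sum_exp_mul_sum_sgn, mul_pow]
  have hcosh : Real.cosh b ^ m ≤ Real.exp (s ^ 2 * η ^ 4 / (2 * m)) := by
    calc Real.cosh b ^ m ≤ (Real.exp (b ^ 2 / 2)) ^ m :=
          pow_le_pow_left₀ (Real.cosh_pos b).le (Real.cosh_le_exp_half_sq b) m
      _ = Real.exp (s ^ 2 * η ^ 4 / (2 * m)) := by
          rw [← Real.exp_nat_mul, hb]; congr 1; field_simp
  calc (2 : ℝ) ^ m * ((2 : ℝ) ^ m * Real.cosh b ^ m) / (2 ^ m * 2 ^ m) = Real.cosh b ^ m := by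
        field_simp
    _ ≤ _ := hcosh

end ingster

section main

/-- **Indistinguishability of the Paninski mixture (Le Cam + Ingster).** For `m ≥ 1`, `η² ≤ 1` and ANY
`[0,1]`-valued acceptance function `φ` on transcripts of `s` samples from the `2m`-point space,
`𝔼_{U^{⊗s}}[φ] − avg_z 𝔼_{P_z^{⊗s}}[φ] ≤ ½ √(exp(s²η⁴/(2m)) − 1)`: “the distance between the distributions of a
transcript from the uniform distribution and a transcript from a no-distribution is small” unless
`s ≳ √m/η²`. [cite: Canonne2020, §5.1 (“An Ω(√n/ε²) lower bound”, Paninski [79]) and App. E.2 Cor. E.8 (“An application: testing uniformity”)] [cite: Paninski2008, lower bound Ω(√n/ε²) (as restated in Canonne2020)] -/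
theorem accept_unif_sub_avg_le (hm : 0 < m) {η : ℝ} (hη : η ^ 2 ≤ 1) {s : ℕ}
    (φ : (Fin s → Fin m × Bool) → ℝ) (hφ0 : ∀ S, 0 ≤ φ S) (hφ1 : ∀ S, φ S ≤ 1) :
    accept (unif m) φ - (∑ z : Fin m → Bool, accept (paninski η z) φ) / 2 ^ m ≤
      Real.sqrt (Real.exp (s ^ 2 * η ^ 4 / (2 * m)) - 1) / 2 := by
  have hm' : (0 : ℝ) < m := by exact_mod_cast hm
  -- the average acceptance is the acceptance under the mixture
  have havg : (∑ z : Fin m → Bool, accept (paninski η z) φ) / 2 ^ m =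
      ∑ S, φ S * mix η m s S := by
    unfold accept mix
    rw [sum_comm, Finset.sum_div]
    refine sum_congr rfl fun S _ => ?_
    rw [← Finset.mul_sum, mul_div_assoc]
  rw [havg, accept]
  -- Le Cam
  have hU1 : ∑ S : Fin s → Fin m × Bool, prodW (unif m) S = 1 := by
    rw [sum_prodW, sum_unif hm, one_pow]
  have hLC := accept_sub_le_half_l1 (fun S => prodW (unif m) S) (mix η m s) (by rw [hU1, sum_mix hm])
    φ hφ0 hφ1
  refine hLC.trans (div_le_div_of_nonneg_right ?_ (by norm_num))
  -- Cauchy–Schwarz against the constant uniform weight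
  have hc : (1 / (2 * (m : ℝ))) ^ s * Fintype.card (Fin s → Fin m × Bool) = 1 := by
    rw [card_seq]; push_cast
    rw [← mul_pow, one_div, inv_mul_cancel₀ (by positivity), one_pow]
  have hCS := l1_sq_le_card_mul_sum_sq (mix η m s) (sum_mix hm η s) hc
  have hchi := card_mul_sum_mix_sq_le hm hη s
  have hl1 : (∑ S : Fin s → Fin m × Bool, |prodW (unif m) S - mix η m s S|) ^ 2 ≤
      Real.exp (s ^ 2 * η ^ 4 / (2 * m)) - 1 := by
    have : ∑ S : Fin s → Fin m × Bool, |prodW (unif m) S - mix η m s S| =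
        ∑ S : Fin s → Fin m × Bool, |mix η m s S - (1 / (2 * (m : ℝ))) ^ s| := by
      refine sum_congr rfl fun S _ => ?_; rw [prodW_unif, abs_sub_comm]
    rw [this]; linarith
  have habs := Real.abs_le_sqrt hl1
  rwa [abs_of_nonneg (sum_nonneg fun S _ => abs_nonneg _)] at habs

/-- `exp x ≤ 13/9` for `x ≤ 4/13`, from `exp x ≤ 1/(1 − x)` (numerical plumbing). [folklore] -/
private theorem exp_le_of_le {x : ℝ} (hx : x ≤ 4 / 13) : Real.exp x ≤ 13 / 9 := by
  rcases le_or_gt 0 x with h0 | h0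
  · calc Real.exp x ≤ 1 / (1 - x) := Real.exp_bound_div_one_sub_of_interval h0 (by linarith)
      _ ≤ 13 / 9 := by
          rw [div_le_div_iff₀ (by linarith) (by norm_num)]; linarith
  · have := Real.exp_lt_one_iff.2 h0
    linarith

/-- **Paninski's sample-complexity lower bound for uniformity testing, tester form.** If a `[0,1]`-valued
test on `s` samples accepts the uniform distribution on `2m ≥ 2` points with probability `≥ 2/3` and
accepts every perturbation `P_z` (`η² ≤ 1`; each exactly `|η|`-far from uniform in `ℓ₁`) with probability
`< 1/3`, then `s²η⁴ > (8/13)·m`, i.e. `s > 0.78 √m/η²` — “any algorithm taking fewer than `c√n/ε²` samples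
… cannot distinguish”; with `η = 2ϵ` this is `s = Ω(√n/ϵ²)` for `ℓ₁`-accuracy `2ϵ` on `n = 2m` points.
This is the lower-bound half of Valiant–Valiant's Theorem (Hangleiter et al.'s Theorem 2) for the FLAT
target, which the tree's `CertificationSampleComplexity.lean` takes as a hypothesis.
[cite: Canonne2020, §5.1 (“Paninski [79] … proved a matching Ω(√n/ε²) lower bound”) and App. E.2 Cor. E.8] [cite: Paninski2008, lower bound Ω(√n/ε²) (as restated in Canonne2020)] -/
theorem samples_sq_gt (hm : 0 < m) {η : ℝ} (hη : η ^ 2 ≤ 1) {s : ℕ}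
    (φ : (Fin s → Fin m × Bool) → ℝ) (hφ0 : ∀ S, 0 ≤ φ S) (hφ1 : ∀ S, φ S ≤ 1)
    (hcomplete : 2 / 3 ≤ accept (unif m) φ) (hsound : ∀ z, accept (paninski η z) φ < 1 / 3) :
    8 * (m : ℝ) / 13 < (s : ℝ) ^ 2 * η ^ 4 := by
  have hm' : (0 : ℝ) < m := by exact_mod_cast hm
  have hmain := accept_unif_sub_avg_le hm hη φ hφ0 hφ1
  have havg : (∑ z : Fin m → Bool, accept (paninski η z) φ) / 2 ^ m < 1 / 3 := by
    rw [div_lt_iff₀ (by positivity)]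
    calc ∑ z : Fin m → Bool, accept (paninski η z) φ < ∑ _z : Fin m → Bool, (1 / 3 : ℝ) :=
          sum_lt_sum_of_nonempty univ_nonempty fun z _ => hsound z
      _ = 1 / 3 * 2 ^ m := by
          simp [Fintype.card_bool, Fintype.card_fin]; ring
  set x := (s : ℝ) ^ 2 * η ^ 4 / (2 * m) with hx
  have hgt : 1 / 3 < Real.sqrt (Real.exp x - 1) / 2 := by linarith
  by_contra hle
  push Not at hle
  have hxle : x ≤ 4 / 13 := by
    rw [hx, div_le_div_iff₀ (by positivity) (by norm_num)]; linarith
  have hexp := exp_le_of_le hxle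
  have hsq : Real.sqrt (Real.exp x - 1) ≤ 2 / 3 :=
    calc Real.sqrt (Real.exp x - 1) ≤ Real.sqrt ((2 / 3) ^ 2) := Real.sqrt_le_sqrt (by linarith)
      _ = 2 / 3 := Real.sqrt_sq (by norm_num)
  linarith

end main

/-! ## v2 — Odd (indeed arbitrary) sample-space sizes: `m` perturbed pairs plus `r` unperturbed points

“taking without loss of generality the domain to be `[n]` and `n` to be even” [cite: Canonne2020, §5.1] —
the loss of generality is removed here: on the `(2m + r)`-point space `(Fin m × Bool) ⊕ Fin r` Paninski's
family perturbs the `m` pairs and leaves the `r` extra points at the uniform weight.  Each `P_z` is then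
`|η|·2m/(2m+r)`-far from uniform in `ℓ₁`, the pair overlap is `(1 + (2η²/(2m+r))⟨σ(z),σ(z')⟩)/(2m+r)`,
Ingster's identity and the `cosh` bound go through verbatim, and the indistinguishability bound becomes
`½√(exp(s²η⁴/(2m+r)) − 1)` (for `r = 0` exactly the bound above).  Only the constants change. -/

section padded

variable {r : ℕ}

/-- The `(2m + r)`-point sample space: `m` pairs and `r` unperturbed points. [cite: Canonne2020, §5.1 (“taking without loss of generality … n to be even”)] -/
abbrev PSpace (m r : ℕ) := (Fin m × Bool) ⊕ Fin r

/-- The uniform distribution on `2m + r` points. [cite: Canonne2020, §5.1] -/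
def unifP (m r : ℕ) : PSpace m r → ℝ := fun _ => 1 / (2 * m + r)

/-- Paninski's family padded by `r` unperturbed points: `P_z(j,b) = (1 + ησ(z_j)σ(b))/(2m+r)` on the pairs,
`P_z(i) = 1/(2m+r)` on the extra points. [cite: Canonne2020, §5.1 (construction of D_no)] [cite: Paninski2008, lower-bound construction (as restated in Canonne2020 §5.1)] -/
def paninskiP (η : ℝ) (z : Fin m → Bool) : PSpace m r → ℝ
  | Sum.inl x => (1 + η * sgn (z x.1) * sgn x.2) / (2 * m + r)
  | Sum.inr _ => 1 / (2 * m + r)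

/-- The uniform mixture of the padded product distributions. [cite: Canonne2020, §5.1 (the mixture 𝔼_{D∼D_no}[D^{⊗m}])] -/
def mixP (η : ℝ) (m r s : ℕ) (S : Fin s → PSpace m r) : ℝ :=
  (∑ z : Fin m → Bool, prodW (paninskiP (r := r) η z) S) / 2 ^ m

/-- `|(Fin m × Bool) ⊕ Fin r| = 2m + r` (plumbing). [folklore] -/
private theorem card_pspace : Fintype.card (PSpace m r) = 2 * m + r := by
  simp [Fintype.card_sum, Fintype.card_prod, mul_comm]

/-- Sums over the padded space split into the pairs and the extra points (plumbing). [folklore] -/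
private theorem sum_pspace (f : PSpace m r → ℝ) :
    ∑ x, f x = ∑ j : Fin m, (f (Sum.inl (j, false)) + f (Sum.inl (j, true))) + ∑ i : Fin r, f (Sum.inr i) := by
  rw [Fintype.sum_sum_type, Fintype.sum_prod_type]
  congr 1
  refine sum_congr rfl fun j _ => ?_
  rw [Fintype.sum_bool, add_comm]

/-- `U` is a probability vector (`m ≥ 1`). [cite: Canonne2020, §5.1] -/
theorem sum_unifP (hm : 0 < m) : ∑ x, unifP m r x = 1 := by
  have : (0 : ℝ) < 2 * m + r := by positivity
  simp only [unifP, sum_const, card_univ, card_pspace, nsmul_eq_mul]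
  push_cast
  field_simp

/-- Each padded `P_z` is a probability vector. [cite: Canonne2020, §5.1 (construction of D_no)] -/
theorem sum_paninskiP (hm : 0 < m) (η : ℝ) (z : Fin m → Bool) : ∑ x, paninskiP (r := r) η z x = 1 := by
  have h0 : (0 : ℝ) < 2 * m + r := by positivity
  rw [sum_pspace]
  simp only [paninskiP, sgn]
  simp only [Bool.false_eq_true, ↓reduceIte, mul_one, mul_neg, ← add_div]
  rw [← Finset.sum_div]
  have : ∀ j : Fin m, (1 + η * (if z j = true then (-1:ℝ) else 1)) +
      (1 + -(η * if z j = true then (-1:ℝ) else 1)) = 2 := fun j => by ring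
  simp_rw [this]
  simp only [sum_const, card_univ, Fintype.card_fin, nsmul_eq_mul]
  field_simp

/-- `P_z ≥ 0` for `|η| ≤ 1`. [cite: Canonne2020, §5.1 (construction of D_no)] -/
theorem paninskiP_nonneg {η : ℝ} (hη : |η| ≤ 1) (z : Fin m → Bool) (x : PSpace m r) :
    0 ≤ paninskiP η z x := by
  rcases x with x | i
  · simp only [paninskiP]
    apply div_nonneg _ (by positivity)
    have h : |η * sgn (z x.1) * sgn x.2| ≤ 1 := by
      rw [abs_mul, abs_mul, abs_sgn, abs_sgn, mul_one, mul_one]; exact hη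
    have := neg_abs_le (η * sgn (z x.1) * sgn x.2)
    linarith
  · simp only [paninskiP]
    positivity

/-- **Each padded `P_z` is exactly `|η|·2m/(2m+r)`-far from uniform in `ℓ₁`** (the extra points carry no
difference). [cite: Canonne2020, §5.1 (“Each such distribution is thus being exactly ε-far from uniform”)] -/
theorem l1_paninskiP_unifP (hm : 0 < m) (η : ℝ) (z : Fin m → Bool) :
    ∑ x, |paninskiP (r := r) η z x - unifP m r x| = |η| * (2 * m) / (2 * m + r) := by
  have h0 : (0 : ℝ) < 2 * m + r := by positivity
  rw [sum_pspace]
  have hpair : ∀ (j : Fin m) (b : Bool),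
      |paninskiP (r := r) η z (Sum.inl (j, b)) - unifP m r (Sum.inl (j, b))| = |η| / (2 * m + r) := by
    intro j b
    simp only [paninskiP, unifP]
    rw [← sub_div, abs_div, abs_of_pos h0]
    congr 1
    rw [add_sub_cancel_left, abs_mul, abs_mul, abs_sgn, abs_sgn, mul_one, mul_one]
  have hextra : ∀ i : Fin r, |paninskiP (r := r) η z (Sum.inr i) - unifP m r (Sum.inr i)| = 0 := by
    intro i; simp [paninskiP, unifP]
  simp_rw [hpair, hextra]
  simp only [sum_const, card_univ, Fintype.card_fin, nsmul_eq_mul, smul_zero, add_zero]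
  field_simp
  ring

/-- **The padded pair overlap**: `Σ_x P_z(x)P_{z'}(x) = (1 + (2η²/(2m+r))⟨σ(z),σ(z')⟩)/(2m+r)`.
[cite: Canonne2020, §5.1 (“expanding the inner square”) and App. E.2] -/
theorem overlapP (hm : 0 < m) (η : ℝ) (z z' : Fin m → Bool) :
    ∑ x, paninskiP (r := r) η z x * paninskiP (r := r) η z' x =
      (1 + 2 * η ^ 2 / (2 * m + r) * ∑ j, sgn (z j) * sgn (z' j)) / (2 * m + r) := by
  have h0 : (2 * (m : ℝ) + r) ≠ 0 := by positivity
  rw [sum_pspace]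
  have hpair : ∀ j : Fin m, paninskiP (r := r) η z (Sum.inl (j, false)) * paninskiP (r := r) η z' (Sum.inl (j, false)) +
      paninskiP (r := r) η z (Sum.inl (j, true)) * paninskiP (r := r) η z' (Sum.inl (j, true)) =
      (2 + 2 * η ^ 2 * (sgn (z j) * sgn (z' j))) / (2 * m + r) ^ 2 := by
    intro j
    simp only [paninskiP, sgn, Bool.false_eq_true, ↓reduceIte]
    field_simp
    ring
  have hextra : ∀ i : Fin r, paninskiP (r := r) η z (Sum.inr i) * paninskiP (r := r) η z' (Sum.inr i) =
      1 / (2 * m + r) ^ 2 := by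
    intro i; simp only [paninskiP]; field_simp
  simp_rw [hpair, hextra]
  rw [← Finset.sum_div, Finset.sum_add_distrib, sum_const, card_univ, Fintype.card_fin, nsmul_eq_mul,
    ← Finset.mul_sum, sum_const, card_univ, Fintype.card_fin, nsmul_eq_mul]
  field_simp
  ring

/-- `U^{⊗s}` is the constant `(2m+r)^{−s}`. [folklore] -/
private theorem prodW_unifP (s : ℕ) (S : Fin s → PSpace m r) :
    prodW (unifP m r) S = (1 / (2 * m + r)) ^ s := by
  simp [prodW, unifP]

/-- There are `(2m+r)^s` transcripts. [folklore] -/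
private theorem card_seqP (s : ℕ) : Fintype.card (Fin s → PSpace m r) = (2 * m + r) ^ s := by
  rw [Fintype.card_fun, card_pspace, Fintype.card_fin]

/-- The padded mixture is a probability vector on transcripts. [cite: Canonne2020, §5.1 (definition of the mixture)] -/
theorem sum_mixP (hm : 0 < m) (η : ℝ) (s : ℕ) : ∑ S : Fin s → PSpace m r, mixP η m r s S = 1 := by
  unfold mixP
  rw [← Finset.sum_div, sum_comm]
  simp_rw [sum_prodW, sum_paninskiP hm, one_pow]
  simp

/-- **Ingster's identity, padded**: `K Σ_S Ū(S)² = 2^{−2m} Σ_{z,z'} (1 + (2η²/(2m+r))⟨σ(z),σ(z')⟩)^s`,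
`K = (2m+r)^s`. [cite: Canonne2020, §5.1 (proof sketch) and App. E.2] -/
theorem card_mul_sum_mixP_sq (hm : 0 < m) (η : ℝ) (s : ℕ) :
    (Fintype.card (Fin s → PSpace m r) : ℝ) * ∑ S : Fin s → PSpace m r, mixP η m r s S ^ 2 =
      (∑ z : Fin m → Bool, ∑ z' : Fin m → Bool,
        (1 + 2 * η ^ 2 / (2 * m + r) * ∑ j, sgn (z j) * sgn (z' j)) ^ s) / (2 ^ m * 2 ^ m) := by
  have h0 : (0 : ℝ) < 2 * m + r := by positivity
  rw [card_seqP]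
  push_cast
  have hsq : ∀ S : Fin s → PSpace m r, mixP η m r s S ^ 2 =
      (∑ z : Fin m → Bool, ∑ z' : Fin m → Bool,
        prodW (paninskiP (r := r) η z) S * prodW (paninskiP (r := r) η z') S) / (2 ^ m * 2 ^ m) := by
    intro S
    rw [mixP, div_pow, sq, sum_mul_sum, sq]
  simp_rw [hsq]
  rw [← Finset.sum_div, sum_comm]
  simp_rw [Finset.sum_comm (s := (univ : Finset (Fin s → PSpace m r))), sum_prodW_mul,
    overlapP hm, div_pow]
  rw [mul_div_assoc']
  congr 1
  rw [Finset.mul_sum]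
  refine sum_congr rfl fun z _ => ?_
  rw [Finset.mul_sum]
  refine sum_congr rfl fun z' _ => ?_
  have h2m : ((2 : ℝ) * m + r) ^ s ≠ 0 := by positivity
  field_simp

/-- **The χ² bound, padded**: `K Σ_S Ū(S)² ≤ cosh(2sη²/(2m+r))^m ≤ exp(s²η⁴/(2m+r))` for `η² ≤ 1`.
[cite: Canonne2020, §5.1 (“one can finally obtain an upper bound of (e^{m²ε⁴/n} − 1)^{1/2}”)] -/
theorem card_mul_sum_mixP_sq_le (hm : 0 < m) {η : ℝ} (hη : η ^ 2 ≤ 1) (s : ℕ) :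
    (Fintype.card (Fin s → PSpace m r) : ℝ) * ∑ S : Fin s → PSpace m r, mixP η m r s S ^ 2 ≤
      Real.exp (s ^ 2 * η ^ 4 / (2 * m + r)) := by
  have hm' : (0 : ℝ) < m := by exact_mod_cast hm
  have h0 : (0 : ℝ) < 2 * m + r := by positivity
  rw [card_mul_sum_mixP_sq hm]
  set b : ℝ := s * (2 * η ^ 2 / (2 * m + r)) with hb
  have hstep : ∑ z : Fin m → Bool, ∑ z' : Fin m → Bool,
      (1 + 2 * η ^ 2 / (2 * m + r) * ∑ j, sgn (z j) * sgn (z' j)) ^ s ≤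
      ∑ z : Fin m → Bool, ∑ z' : Fin m → Bool, Real.exp (b * ∑ j, sgn (z j) * sgn (z' j)) := by
    refine sum_le_sum fun z _ => sum_le_sum fun z' _ => ?_
    have hI := neg_le_sum_sgn_mul z z'
    have hx : 0 ≤ 1 + 2 * η ^ 2 / (2 * m + r) * ∑ j, sgn (z j) * sgn (z' j) := by
      have h1 : 2 * η ^ 2 / (2 * m + r) * (-(m : ℝ)) ≤ 2 * η ^ 2 / (2 * m + r) * ∑ j, sgn (z j) * sgn (z' j) :=
        mul_le_mul_of_nonneg_left hI (by positivity)
      have h2 : 2 * η ^ 2 / (2 * m + r) * (-(m : ℝ)) = -(η ^ 2 * (2 * m / (2 * m + r))) := by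
        field_simp
      have h3 : η ^ 2 * (2 * m / (2 * m + r)) ≤ 1 := by
        have h4 : 2 * (m : ℝ) / (2 * m + r) ≤ 1 := by
          rw [div_le_one h0]; linarith [(Nat.cast_nonneg r : (0 : ℝ) ≤ r)]
        calc η ^ 2 * (2 * m / (2 * m + r)) ≤ 1 * 1 :=
              mul_le_mul hη h4 (by positivity) zero_le_one
          _ = 1 := one_mul 1
      linarith
    refine (one_add_pow_le_exp_mul hx s).trans (le_of_eq ?_)
    rw [hb]; ring_nf
  refine (div_le_div_of_nonneg_right hstep (by positivity)).trans ?_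
  rw [sum_sum_exp_mul_sum_sgn, mul_pow]
  have hcosh : Real.cosh b ^ m ≤ Real.exp (s ^ 2 * η ^ 4 / (2 * m + r)) := by
    calc Real.cosh b ^ m ≤ (Real.exp (b ^ 2 / 2)) ^ m :=
          pow_le_pow_left₀ (Real.cosh_pos b).le (Real.cosh_le_exp_half_sq b) m
      _ = Real.exp (m * (b ^ 2 / 2)) := by rw [← Real.exp_nat_mul]
      _ ≤ Real.exp (s ^ 2 * η ^ 4 / (2 * m + r)) := by
          rw [Real.exp_le_exp, hb]
          -- `m · (2sη²/(2m+r))²/2 = 2m s²η⁴/(2m+r)² ≤ s²η⁴/(2m+r)` since `2m ≤ 2m + r`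
          have hr : (0 : ℝ) ≤ r := Nat.cast_nonneg r
          rw [show (m : ℝ) * ((s * (2 * η ^ 2 / (2 * m + r))) ^ 2 / 2) =
              (s ^ 2 * η ^ 4 / (2 * m + r)) * (2 * m / (2 * m + r)) by field_simp]
          have h4 : 2 * (m : ℝ) / (2 * m + r) ≤ 1 := by rw [div_le_one h0]; linarith
          calc s ^ 2 * η ^ 4 / (2 * m + r) * (2 * m / (2 * m + r))
              ≤ s ^ 2 * η ^ 4 / (2 * m + r) * 1 := mul_le_mul_of_nonneg_left h4 (by positivity)
            _ = _ := mul_one _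
  calc (2 : ℝ) ^ m * ((2 : ℝ) ^ m * Real.cosh b ^ m) / (2 ^ m * 2 ^ m) = Real.cosh b ^ m := by
        field_simp
    _ ≤ _ := hcosh

/-- **Indistinguishability of the padded Paninski mixture**: for `m ≥ 1`, `η² ≤ 1`, any `r` and ANY
`[0,1]`-valued acceptance function `φ` on transcripts of `s` samples from the `(2m+r)`-point space,
`𝔼_{U^{⊗s}}[φ] − avg_z 𝔼_{P_z^{⊗s}}[φ] ≤ ½√(exp(s²η⁴/(2m+r)) − 1)`.
[cite: Canonne2020, §5.1 and App. E.2 Cor. E.8] [cite: Paninski2008, lower bound Ω(√n/ε²) (as restated in Canonne2020)] -/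
theorem accept_unifP_sub_avg_le (hm : 0 < m) {η : ℝ} (hη : η ^ 2 ≤ 1) {s : ℕ}
    (φ : (Fin s → PSpace m r) → ℝ) (hφ0 : ∀ S, 0 ≤ φ S) (hφ1 : ∀ S, φ S ≤ 1) :
    accept (unifP m r) φ - (∑ z : Fin m → Bool, accept (paninskiP (r := r) η z) φ) / 2 ^ m ≤
      Real.sqrt (Real.exp (s ^ 2 * η ^ 4 / (2 * m + r)) - 1) / 2 := by
  have h0 : (0 : ℝ) < 2 * m + r := by positivity
  have havg : (∑ z : Fin m → Bool, accept (paninskiP (r := r) η z) φ) / 2 ^ m =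
      ∑ S, φ S * mixP η m r s S := by
    unfold accept mixP
    rw [sum_comm, Finset.sum_div]
    refine sum_congr rfl fun S _ => ?_
    rw [← Finset.mul_sum, mul_div_assoc]
  rw [havg, accept]
  have hU1 : ∑ S : Fin s → PSpace m r, prodW (unifP m r) S = 1 := by
    rw [sum_prodW, sum_unifP hm, one_pow]
  have hLC := accept_sub_le_half_l1 (fun S => prodW (unifP m r) S) (mixP η m r s)
    (by rw [hU1, sum_mixP hm]) φ hφ0 hφ1
  refine hLC.trans (div_le_div_of_nonneg_right ?_ (by norm_num))
  have hc : (1 / (2 * (m : ℝ) + r)) ^ s * Fintype.card (Fin s → PSpace m r) = 1 := by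
    rw [card_seqP]; push_cast
    rw [← mul_pow, one_div, inv_mul_cancel₀ (by positivity), one_pow]
  have hCS := l1_sq_le_card_mul_sum_sq (mixP η m r s) (sum_mixP hm η s) hc
  have hchi := card_mul_sum_mixP_sq_le (r := r) hm hη s
  have hl1 : (∑ S : Fin s → PSpace m r, |prodW (unifP m r) S - mixP η m r s S|) ^ 2 ≤
      Real.exp (s ^ 2 * η ^ 4 / (2 * m + r)) - 1 := by
    have : ∑ S : Fin s → PSpace m r, |prodW (unifP m r) S - mixP η m r s S| =
        ∑ S : Fin s → PSpace m r, |mixP η m r s S - (1 / (2 * (m : ℝ) + r)) ^ s| := by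
      refine sum_congr rfl fun S _ => ?_; rw [prodW_unifP, abs_sub_comm]
    rw [this]; linarith
  have habs := Real.abs_le_sqrt hl1
  rwa [abs_of_nonneg (sum_nonneg fun S _ => abs_nonneg _)] at habs

/-- **Paninski's lower bound on `2m + r` points, tester form.** Completeness `≥ 2/3` on `U` and acceptance
`< 1/3` on every padded `P_z` (`η² ≤ 1`) force `s²η⁴ > (4/13)(2m + r)` (for `r = 0`: `(8/13)m`, as above).
[cite: Canonne2020, §5.1 (“Paninski [79] … proved a matching Ω(√n/ε²) lower bound”) and App. E.2 Cor. E.8] [cite: Paninski2008, lower bound Ω(√n/ε²) (as restated in Canonne2020)] -/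
theorem samples_sq_gtP (hm : 0 < m) {η : ℝ} (hη : η ^ 2 ≤ 1) {s : ℕ}
    (φ : (Fin s → PSpace m r) → ℝ) (hφ0 : ∀ S, 0 ≤ φ S) (hφ1 : ∀ S, φ S ≤ 1)
    (hcomplete : 2 / 3 ≤ accept (unifP m r) φ)
    (hsound : ∀ z, accept (paninskiP (r := r) η z) φ < 1 / 3) :
    4 * (2 * (m : ℝ) + r) / 13 < (s : ℝ) ^ 2 * η ^ 4 := by
  have h0 : (0 : ℝ) < 2 * m + r := by positivity
  have hmain := accept_unifP_sub_avg_le (r := r) hm hη φ hφ0 hφ1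
  have havg : (∑ z : Fin m → Bool, accept (paninskiP (r := r) η z) φ) / 2 ^ m < 1 / 3 := by
    rw [div_lt_iff₀ (by positivity)]
    calc ∑ z : Fin m → Bool, accept (paninskiP (r := r) η z) φ < ∑ _z : Fin m → Bool, (1 / 3 : ℝ) :=
          sum_lt_sum_of_nonempty univ_nonempty fun z _ => hsound z
      _ = 1 / 3 * 2 ^ m := by
          simp [Fintype.card_bool, Fintype.card_fin]; ring
  set x := (s : ℝ) ^ 2 * η ^ 4 / (2 * m + r) with hx
  have hgt : 1 / 3 < Real.sqrt (Real.exp x - 1) / 2 := by linarith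
  by_contra hle
  push Not at hle
  have hxle : x ≤ 4 / 13 := by
    rw [hx, div_le_div_iff₀ h0 (by norm_num)]; linarith
  have hexp := exp_le_of_le hxle
  have hsq : Real.sqrt (Real.exp x - 1) ≤ 2 / 3 :=
    calc Real.sqrt (Real.exp x - 1) ≤ Real.sqrt ((2 / 3) ^ 2) := Real.sqrt_le_sqrt (by linarith)
      _ = 2 / 3 := Real.sqrt_sq (by norm_num)
  linarith

end padded

end UniformityTesting
end Literature.Probability.HypothesisTesting
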